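import Mathlib
import Summits.Ventures.PercRepro2.Graph
import Summits.Ventures.PercRepro2.Exploration
import Summits.Ventures.PercRepro2.Harris
import Summits.Ventures.PercRepro2.GibbsPAJoint
import Summits.Ventures.PercRepro2.SepClusterJoint
import Summits.Ventures.PercRepro2.SepClusterSupport
import Summits.Ventures.PercRepro2.SepClusterHarris
import Summits.Ventures.PercRepro2.SepFamJoint
import Summits.Ventures.PercRepro2.SepFamSupport
import Summits.Ventures.PercRepro2.SepFamHarris
import Summits.Ventures.PercRepro2.SepFamPA
import Summits.Ventures.PercRepro2.SepFamClosed
import Summits.Ventures.PercRepro2.SepFamClosedAB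
import Summits.Ventures.PercRepro2.SepFamMono

/-!
# Separating the avoided roots from each other enlarges the explored clusters — the one
three-cluster inequality that does follow from BHK06 (blind cell PercRepro2, p3 g13, 2026-08-27;
`proofs/P3-K3.md` §5 (T))

For root sets `X` (explored) and `W` (avoided), `S = {W ↮ X}`, and `Z ∪ T ⊆ W`: conditioning in
addition on `{Z ↮ T}` makes the tuple of clusters of `X` stochastically LARGER —

  `E[1_S g(expl X)] · P(S ∧ Z ↮ T) ≤ E[1_S g(expl X) 1_{Z ↮ T}] · P(S)`   for monotone `g`

(`sep_fam_tilt`; `sep_fam_tilt_closed` for all weights in `[0,1]`).  In the three-root case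
`X = {x₁}`, `W = {x₂, x₃}`, `Z = {x₂}`, `T = {x₃}`: `P(g(C(x₁)) | S₃) ≥ P(g(C(x₁)) | x₁ ↮ {x₂, x₃})`.
Proof: by the domain Markov property `P(Z ↮ T | expl X = t, S) = 1 − crossAway Z T t =: φ(t)`
(`prob_sepFam_inter_cross` / `expect_indicator_expl_cross` below), a MONOTONE function of the tuple
(`antitone_crossAway`); so both sides are expectations of functions of `expl X` under `P(· | S)`, and
the inequality is Theorem A / BHK06 Thm 1.3 (`sep_fam_pa`) for the pair `g, φ`.  This is the only
part of the three-cluster picture that survives: the cross negative association, the within positive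
association and the union positive association all FAIL for three pairwise-separated roots
(`K3CrossCounterexample`, `SepExtensionCounterexamples`, `K3WithinCounterexample`).  Own work on the
cell's `SepPA` chain; standard axioms.
-/

namespace Summit.Ventures.PercRepro2

namespace SepPA

open Finset Classical

section FamilyTilt

variable {V : Type*} {E : Type*} [Fintype V] [Fintype E] [DecidableEq E]
variable (ends : E → Sym2 V) (p : E → ℝ)

omit [Fintype V] [Fintype E] [DecidableEq E] in
/-- Indicators of an intersection. -/
lemma indicator_inter_one (A B : Set (Config E)) (ω : Config E) :
    A.indicator (fun _ => (1 : ℝ)) ω * B.indicator (fun _ => (1 : ℝ)) ω =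
      (A ∩ B).indicator (fun _ => (1 : ℝ)) ω := by
  by_cases hA : ω ∈ A <;> by_cases hB : ω ∈ B <;> simp [hA, hB]

/-- `E[1_{W ↮ X} g(expl X) 1_{Z ~ T}] = E[1_{W ↮ X} g(expl X) crossAway Z T (expl X)]` for
`Z ∪ T ⊆ W` (domain Markov for a crossing, weighted by a function of the tuple). -/
lemma expect_indicator_expl_cross (Z T W X : Finset V) (hZT : Z ∪ T ⊆ W)
    (g : (X → Set V) → ℝ) :
    expect p (fun ω => (sepFam ends W X ∩ crossEvent ends (Z : Set V) (T : Set V)).indicator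
        (fun _ => (1 : ℝ)) ω * g (expl ends ω X)) =
      expect p (fun ω => (sepFam ends W X).indicator (fun _ => (1 : ℝ)) ω *
        (g (expl ends ω X) * crossAway ends p Z T (expl ends ω X))) := by
  rw [expect_indicator_comp_eq_sum p (sepFam ends W X ∩ crossEvent ends (Z : Set V) (T : Set V))
    (fun ω => expl ends ω X) g,
    expect_indicator_comp_eq_sum p (sepFam ends W X) (fun ω => expl ends ω X)
    (fun t => g t * crossAway ends p Z T t)]
  apply Finset.sum_congr rfl
  intro t _
  rw [Set.inter_comm (sepFam ends W X) {ω | expl ends ω X = t}, ← explEvent_eq_preimage]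
  by_cases hW : ∀ w ∈ W, w ∉ foot t
  · have hZT' : ∀ w ∈ Z ∪ T, w ∉ foot t := fun w hw => hW w (hZT hw)
    have hsub : explEvent ends X t ∩ sepFam ends W X = explEvent ends X t :=
      Set.inter_eq_left.mpr (fun ω hω => mem_sepFam_of_explEvent hω hW)
    have e : sepFam ends W X ∩ crossEvent ends (Z : Set V) (T : Set V) ∩ explEvent ends X t =
        explEvent ends X t ∩ crossEvent ends (Z : Set V) (T : Set V) := by
      ext ω
      simp only [Set.mem_inter_iff]
      constructor
      · rintro ⟨⟨_, hc⟩, ht⟩; exact ⟨ht, hc⟩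
      · rintro ⟨ht, hc⟩; exact ⟨⟨mem_sepFam_of_explEvent ht hW, hc⟩, ht⟩
    rw [e, prob_explEvent_inter_cross ends p hZT', hsub]
    ring
  · simp only [not_forall, not_not] at hW
    obtain ⟨w, hw, hwt⟩ := hW
    have e1 : sepFam ends W X ∩ crossEvent ends (Z : Set V) (T : Set V) ∩ explEvent ends X t =
        ∅ := by
      ext ω
      simp only [Set.mem_inter_iff, Set.mem_empty_iff_false, iff_false]
      rintro ⟨⟨hS, _⟩, ht⟩
      exact not_mem_foot_of_sepFam ht hS hw hwt
    have e2 : explEvent ends X t ∩ sepFam ends W X = ∅ := by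
      ext ω
      simp only [Set.mem_inter_iff, Set.mem_empty_iff_false, iff_false]
      rintro ⟨ht, hS⟩
      exact not_mem_foot_of_sepFam ht hS hw hwt
    rw [e1, e2, prob_empty]
    ring

/-- **The tilt inequality**: for `Z ∪ T ⊆ W`, `S = {W ↮ X}` and monotone `g` of the `X`-tuple,
`E[1_S g(expl X)] · P(S ∧ Z ↮ T) ≤ E[1_S g(expl X) 1_{Z ↮ T}] · P(S)` — separating `Z` from `T`
enlarges the explored clusters of `X`.  Weights in `(0,1)`. -/
theorem sep_fam_tilt (hp01 : ∀ e, 0 < p e ∧ p e < 1) (Z T W X : Finset V)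
    (hZT : Z ∪ T ⊆ W) (hWX : Disjoint W X) (g : (X → Set V) → ℝ) (hg : Monotone g) :
    expect p (fun ω => (sepFam ends W X).indicator (fun _ => (1 : ℝ)) ω * g (expl ends ω X)) *
      prob p (sepFam ends W X ∩ (crossEvent ends (Z : Set V) (T : Set V))ᶜ) ≤
    expect p (fun ω => (sepFam ends W X ∩ (crossEvent ends (Z : Set V) (T : Set V))ᶜ).indicator
        (fun _ => (1 : ℝ)) ω * g (expl ends ω X)) *
      prob p (sepFam ends W X) := by
  -- the separation indicator through the crossing indicator
  have hsplit : ∀ (f : Config E → ℝ),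
      expect p (fun ω =>
        (sepFam ends W X ∩ (crossEvent ends (Z : Set V) (T : Set V))ᶜ).indicator
          (fun _ => (1 : ℝ)) ω * f ω) =
      expect p (fun ω => (sepFam ends W X).indicator (fun _ => (1 : ℝ)) ω * f ω) -
      expect p (fun ω => (sepFam ends W X ∩ crossEvent ends (Z : Set V) (T : Set V)).indicator
        (fun _ => (1 : ℝ)) ω * f ω) := by
    intro f
    rw [← expect_sub]
    congr 1
    funext ω
    simp only [Pi.sub_apply]
    by_cases hS : ω ∈ sepFam ends W X <;>
      by_cases hC : ω ∈ crossEvent ends (Z : Set V) (T : Set V) <;> simp [hS, hC]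
  set φ : (X → Set V) → ℝ := fun t => 1 - crossAway ends p Z T t with hφ
  have hφmono : Monotone φ := by
    intro t t' h
    simp only [hφ]
    linarith [antitone_crossAway ends p hp01 Z T h]
  -- P(S ∧ Z ↮ T) = E[1_S φ(expl X)]
  have hP : prob p (sepFam ends W X ∩ (crossEvent ends (Z : Set V) (T : Set V))ᶜ) =
      expect p (fun ω => (sepFam ends W X).indicator (fun _ => (1 : ℝ)) ω * φ (expl ends ω X)) := by
    have hpe : ∀ A : Set (Config E),
        prob p A = expect p (fun ω => A.indicator (fun _ => (1 : ℝ)) ω) := by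
      intro A
      rw [prob_eq_expect_indicator]
      rfl
    have h1 := hsplit (fun _ => (1 : ℝ))
    simp only [mul_one] at h1
    rw [hpe, h1, ← hpe, ← hpe, prob_sepFam_inter_cross ends p Z T W X hZT, hpe (sepFam ends W X),
      ← expect_sub]
    congr 1
    funext ω
    simp only [Pi.sub_apply, hφ]
    ring
  -- E[1_{S ∧ Z ↮ T} g] = E[1_S g φ(expl X)]
  have hG : expect p (fun ω =>
        (sepFam ends W X ∩ (crossEvent ends (Z : Set V) (T : Set V))ᶜ).indicator
          (fun _ => (1 : ℝ)) ω * g (expl ends ω X)) =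
      expect p (fun ω => (sepFam ends W X).indicator (fun _ => (1 : ℝ)) ω *
        (g (expl ends ω X) * φ (expl ends ω X))) := by
    rw [hsplit (fun ω => g (expl ends ω X)), expect_indicator_expl_cross ends p Z T W X hZT g,
      ← expect_sub]
    congr 1
    funext ω
    simp only [Pi.sub_apply, hφ]
    ring
  rw [hP, hG]
  have := sep_fam_pa ends p hp01 hWX g φ hg hφmono
  linarith [this]

/-- **The tilt inequality for all edge weights in `[0, 1]`.** -/
theorem sep_fam_tilt_closed (hp : ∀ e, 0 ≤ p e ∧ p e ≤ 1) (Z T W X : Finset V)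
    (hZT : Z ∪ T ⊆ W) (hWX : Disjoint W X) (g : (X → Set V) → ℝ) (hg : Monotone g) :
    expect p (fun ω => (sepFam ends W X).indicator (fun _ => (1 : ℝ)) ω * g (expl ends ω X)) *
      prob p (sepFam ends W X ∩ (crossEvent ends (Z : Set V) (T : Set V))ᶜ) ≤
    expect p (fun ω => (sepFam ends W X ∩ (crossEvent ends (Z : Set V) (T : Set V))ᶜ).indicator
        (fun _ => (1 : ℝ)) ω * g (expl ends ω X)) *
      prob p (sepFam ends W X) := by
  let F : (E → ℝ) → ℝ := fun q =>
    expect q (fun ω => (sepFam ends W X ∩ (crossEvent ends (Z : Set V) (T : Set V))ᶜ).indicator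
        (fun _ => (1 : ℝ)) ω * g (expl ends ω X)) *
      prob q (sepFam ends W X) -
    expect q (fun ω => (sepFam ends W X).indicator (fun _ => (1 : ℝ)) ω * g (expl ends ω X)) *
      prob q (sepFam ends W X ∩ (crossEvent ends (Z : Set V) (T : Set V))ᶜ)
  have hF : Continuous F :=
    ((continuous_expect _).mul (continuous_prob _)).sub
      ((continuous_expect _).mul (continuous_prob _))
  have h := nonneg_of_nonneg_interior F hF p hp (fun q hq => by
    have := sep_fam_tilt ends q hq Z T W X hZT hWX g hg
    simp only [F]
    linarith)
  simp only [F] at h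
  linarith

end FamilyTilt

end SepPA

end Summit.Ventures.PercRepro2
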